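import Literature.NumberTheory.Transcendental.QuadraticRelationsLogarithmsSec6Fun
import Mathlib.LinearAlgebra.LinearIndependent.BaseChange
import Mathlib.LinearAlgebra.FreeModule.PID
import HarnessLib

/-!
# Roy–Waldschmidt 1997, §5: independent coordinates of a lattice modulo a subgroup (for the count of classes of `Σ`)

D. Roy, M. Waldschmidt, Ann. Sci. ÉNS (4) 30 (1997) 753–796, proof of Théorème 5.1, p. 783:
"et d'autre part `Card((Σ + L(K))/L(K)) ≥ S₁^{λ_a'} S_{ℓ₁}^{λ' - λ_a'}`", where (p. 781)
`Σ = {γ₁^{s₁} ⋯ γ_{ℓ₁}^{s_{ℓ₁}} ; 0 ≤ s₁ ≤ S₁, …, 0 ≤ s_{ℓ₁} ≤ S_{ℓ₁}}`, `γ_j = exp_G(η_j)`,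
`{η₁, …, η_{ℓ₁}}` a basis of `Y` whose first `ℓ_a` elements form a basis of `Y_a` (p. 780),
`λ' = rang_ℤ((Γ + L(K))/L(K))`, `λ_a' = rang_ℤ((Γ_a + L(K))/L(K))`.

The (unprinted) linear algebra behind this count, PROVED here in coordinates: for a subgroup
`N ≤ ℤ^ι` (the coordinate vectors `z` with `∑ zᵢηᵢ ∈ exp_G⁻¹(L)`) and a set of indices `P`
(those of the basis of `Y_a`), there is a set of indices `J` such that no non-zero element of `N`
is supported in `J`, `|J| + rang N ≥ |ι|` and `|J ∩ P| + rang(N ∩ ℤ^P) ≥ |P|`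
(`exists_indep_indices`): pass to `ℚ^ι/N_ℚ`, take a maximal independent subset of the images of
the unit vectors `e_i`, `i ∈ P`, and extend it by images of unit vectors to a basis.  Then the
box points `∑_{i ∈ J} sᵢ ηᵢ`, `0 ≤ sᵢ ≤ Sᵢ`, are pairwise incongruent modulo `exp_G⁻¹(L)`, which
gives the displayed lower bound (`…Sec5Box.lean`).

No definitions besides the cast map `castQL` (a body); no named facts.

## References

* [RoyWaldschmidt1997ENS] D. Roy, M. Waldschmidt, Ann. Sci. ÉNS (4) 30 (1997) 753–796, proof of
  Théorème 5.1, pp. 780–783.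
-/

noncomputable section

open Module Submodule

namespace Literature.NumberTheory.Transcendental

namespace RoyWaldschmidt1997

variable {ι : Type*} [Fintype ι]

/-! ### Integer vectors as rational vectors -/

/-- The cast `ℤ^ι → ℚ^ι` as a `ℤ`-linear map. [folklore] -/
def castQL (ι : Type*) : (ι → ℤ) →ₗ[ℤ] (ι → ℚ) where
  toFun z := fun i => (z i : ℚ)
  map_add' z w := by funext i; simp
  map_smul' c z := by funext i; simp

omit [Fintype ι] in
/-- Unfolding `castQL`. [folklore] -/
@[simp] theorem castQL_apply (z : ι → ℤ) (i : ι) : castQL ι z i = (z i : ℚ) := rfl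

omit [Fintype ι] in
/-- `castQL` is injective. [folklore] -/
theorem castQL_injective : Function.Injective (castQL ι) := by
  intro z w h
  funext i
  have := congrFun h i
  simpa using this

omit [Fintype ι] in
/-- `castQL z = algebraMap ℤ ℚ ∘ z`. [folklore] -/
theorem castQL_eq_comp (z : ι → ℤ) : castQL ι z = algebraMap ℤ ℚ ∘ z := by
  funext i; simp

omit [Fintype ι] in
/-- **The `ℚ`-span of a subgroup `N ≤ ℤ^ι` consists of the vectors with a multiple in `N`.**
[folklore] -/
theorem mem_span_castQL_iff (N : Submodule ℤ (ι → ℤ)) (x : ι → ℚ) :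
    x ∈ span ℚ (castQL ι '' (N : Set (ι → ℤ))) ↔ ∃ k : ℕ, k ≠ 0 ∧ ∃ n ∈ N, (k : ℚ) • x = castQL ι n := by
  constructor
  · intro hx
    induction hx using Submodule.span_induction with
    | mem y hy =>
      obtain ⟨n, hn, rfl⟩ := hy
      exact ⟨1, one_ne_zero, n, hn, by simp⟩
    | zero => exact ⟨1, one_ne_zero, 0, N.zero_mem, by simp⟩
    | add y y' _ _ hy hy' =>
      obtain ⟨k, hk, n, hn, hy⟩ := hy
      obtain ⟨k', hk', n', hn', hy'⟩ := hy'
      refine ⟨k * k', mul_ne_zero hk hk', (k' : ℤ) • n + (k : ℤ) • n', N.add_mem (N.smul_mem _ hn) (N.smul_mem _ hn'), ?_⟩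
      funext i
      have h1 : (k : ℚ) * y i = n i := by simpa using congrFun hy i
      have h2 : (k' : ℚ) * y' i = n' i := by simpa using congrFun hy' i
      simp only [Pi.smul_apply, Pi.add_apply, smul_eq_mul, castQL_apply, zsmul_eq_mul, Pi.mul_apply]
      push_cast
      linear_combination (k' : ℚ) * h1 + (k : ℚ) * h2
    | smul c y _ hy =>
      obtain ⟨k, hk, n, hn, hy⟩ := hy
      -- `c = c.num / c.den`: `(k·den) • (c • y) = num • (k • y) = castQL (num • n)`
      refine ⟨k * c.den, mul_ne_zero hk c.den_ne_zero, c.num • n, N.smul_mem _ hn, ?_⟩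
      have hc : (c.den : ℚ) * c = c.num := by
        have := Rat.mul_den_eq_num c
        rw [mul_comm] at this; exact this
      funext i
      have h1 : (k : ℚ) * y i = n i := by simpa using congrFun hy i
      simp only [Pi.smul_apply, smul_eq_mul, castQL_apply, zsmul_eq_mul, Pi.mul_apply]
      push_cast
      linear_combination ((c.den : ℚ) * c) * h1 + (n i : ℚ) * hc
  · rintro ⟨k, hk, n, hn, h⟩
    have hkQ : (k : ℚ) ≠ 0 := by exact_mod_cast hk
    have : x = (k : ℚ)⁻¹ • castQL ι n := by
      rw [← h, smul_smul, inv_mul_cancel₀ hkQ, one_smul]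
    rw [this]
    exact smul_mem _ _ (subset_span ⟨n, hn, rfl⟩)

/-- **`rang_ℤ N = dim_ℚ N_ℚ`** for a subgroup `N ≤ ℤ^ι` and its `ℚ`-span `N_ℚ`. [folklore] -/
theorem finrank_span_castQL (N : Submodule ℤ (ι → ℤ)) :
    Module.finrank ℚ ↥(span ℚ (castQL ι '' (N : Set (ι → ℤ)))) = Module.finrank ℤ N := by
  classical
  haveI : Module.Finite ℤ N := Module.Finite.of_injective N.subtype N.injective_subtype
  haveI : Module.Free ℤ N := Module.free_of_finite_type_torsion_free'
  let b := Module.Free.chooseBasis ℤ N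
  haveI : Fintype (Module.Free.ChooseBasisIndex ℤ N) := inferInstance
  -- the cast of the basis is `ℚ`-independent and spans `N_ℚ`
  have hbZ : LinearIndependent ℤ (fun k => ((b k : N) : ι → ℤ)) :=
    b.linearIndependent.map' N.subtype (Submodule.ker_subtype N)
  have hli : LinearIndependent ℚ (fun k => castQL ι ((b k : N) : ι → ℤ)) := by
    have h := (linearIndependent_algebraMap_comp_iff (R := ℤ) (S := ℚ)).mpr hbZ
    have e : (fun k => castQL ι ((b k : N) : ι → ℤ)) = fun k => algebraMap ℤ ℚ ∘ ((b k : N) : ι → ℤ) := by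
      funext k; exact castQL_eq_comp _
    rw [e]; exact h
  have hspan : span ℚ (castQL ι '' (N : Set (ι → ℤ))) = span ℚ (Set.range fun k => castQL ι ((b k : N) : ι → ℤ)) := by
    apply le_antisymm
    · refine span_le.mpr ?_
      rintro _ ⟨n, hn, rfl⟩
      have hrepr := b.sum_repr ⟨n, hn⟩
      have : n = ∑ k, (b.repr ⟨n, hn⟩ k) • ((b k : N) : ι → ℤ) := by
        have := congrArg (fun v : N => (v : ι → ℤ)) hrepr
        simp only [Submodule.coe_sum, Submodule.coe_smul_of_tower] at this
        exact this.symm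
      rw [this, map_sum]
      refine sum_mem fun k _ => ?_
      rw [map_smul]
      rw [show ((b.repr ⟨n, hn⟩ k) • castQL ι ((b k : N) : ι → ℤ) : ι → ℚ) =
        ((b.repr ⟨n, hn⟩ k : ℚ)) • castQL ι ((b k : N) : ι → ℤ) from (Int.cast_smul_eq_zsmul ℚ _ _).symm]
      exact smul_mem _ _ (subset_span ⟨k, rfl⟩)
    · refine span_mono ?_
      rintro _ ⟨k, rfl⟩
      exact ⟨_, (b k).2, rfl⟩
  rw [hspan, finrank_span_eq_card hli, Module.finrank_eq_card_basis b]

/-! ### Vectors supported in a set of indices -/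

omit [Fintype ι] in
/-- The integer vectors supported in `P`. [folklore] -/
def suppZ (P : Set ι) : Submodule ℤ (ι → ℤ) where
  carrier := {z | ∀ i, i ∉ P → z i = 0}
  add_mem' := by intro a b ha hb i hi; simp [ha i hi, hb i hi]
  zero_mem' := by intro i _; rfl
  smul_mem' := by intro c a ha i hi; simp [ha i hi]

omit [Fintype ι] in
/-- Membership in `suppZ P`. [folklore] -/
theorem mem_suppZ {P : Set ι} {z : ι → ℤ} : z ∈ suppZ P ↔ ∀ i, i ∉ P → z i = 0 := Iff.rfl

omit [Fintype ι] in
/-- The rational vectors supported in `P`. [folklore] -/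
def suppQ (P : Set ι) : Submodule ℚ (ι → ℚ) where
  carrier := {y | ∀ i, i ∉ P → y i = 0}
  add_mem' := by intro a b ha hb i hi; simp [ha i hi, hb i hi]
  zero_mem' := by intro i _; rfl
  smul_mem' := by intro c a ha i hi; simp [ha i hi]

omit [Fintype ι] in
/-- Membership in `suppQ P`. [folklore] -/
theorem mem_suppQ {P : Set ι} {y : ι → ℚ} : y ∈ suppQ P ↔ ∀ i, i ∉ P → y i = 0 := Iff.rfl

/-- `castQL z = ∑ᵢ zᵢ • eᵢ`. [folklore] -/
theorem castQL_eq_sum_single [DecidableEq ι] (z : ι → ℤ) :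
    castQL ι z = ∑ i, (z i : ℚ) • (Pi.single i (1 : ℚ) : ι → ℚ) := by
  funext j
  simp only [castQL_apply, Finset.sum_apply, Pi.smul_apply, smul_eq_mul]
  rw [Finset.sum_eq_single j]
  · simp
  · intro i _ hij; simp [Pi.single_eq_of_ne' hij]
  · intro h; exact absurd (Finset.mem_univ j) h

/-- **Independent indices modulo a subgroup.**  For a subgroup `N ≤ ℤ^ι` and a set of indices `P`
there is a finite set of indices `J` such that (i) no non-zero element of `N` is supported in `J`,
(ii) `|J| + rang N ≥ |ι|`, (iii) `|J ∩ P| + rang(N ∩ ℤ^P) ≥ |P|` (take, in `ℚ^ι/N_ℚ`, a maximal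
independent subset of the images of the unit vectors `eᵢ`, `i ∈ P`, and extend it by images of unit
vectors to a maximal independent set). [folklore] -/
theorem exists_indep_indices [DecidableEq ι] (N : Submodule ℤ (ι → ℤ)) (P : Finset ι) :
    ∃ J : Finset ι,
      (∀ z ∈ N, (∀ i, i ∉ J → z i = 0) → z = 0) ∧
      Fintype.card ι ≤ J.card + Module.finrank ℤ N ∧
      P.card ≤ (J.filter (· ∈ P)).card + Module.finrank ℤ ↥(N ⊓ suppZ (↑P : Set ι)) := by
  classical
  set NQ : Submodule ℚ (ι → ℚ) := span ℚ (castQL ι '' (N : Set (ι → ℤ))) with hNQ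
  set π : (ι → ℚ) →ₗ[ℚ] (ι → ℚ) ⧸ NQ := NQ.mkQ with hπ
  set e : ι → (ι → ℚ) := fun i => Pi.single i (1 : ℚ) with he
  set v : ι → (ι → ℚ) ⧸ NQ := fun i => π (e i) with hv
  -- step 1: a maximal independent subset of `v '' P`
  obtain ⟨ba, hba_sub, -, hspan_a, hli_a⟩ :=
    exists_linearIndepOn_extension (linearIndepOn_empty ℚ v) (Set.empty_subset (↑P : Set ι))
  -- step 2: extend to all indices
  obtain ⟨B, -, hbaB, hspanB, hliB⟩ := exists_linearIndepOn_extension hli_a (Set.subset_univ ba)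
  refine ⟨B.toFinset, ?_, ?_, ?_⟩
  · -- (i) an element of `N` supported in `B` is zero
    intro z hz hsupp
    have hzQ : castQL ι z ∈ NQ := subset_span ⟨z, hz, rfl⟩
    have hπz : π (castQL ι z) = 0 := by rw [hπ, Submodule.mkQ_apply, Submodule.Quotient.mk_eq_zero]; exact hzQ
    -- the finitely supported coefficient function
    set l : ι →₀ ℚ := Finsupp.equivFunOnFinite.symm (fun i => (z i : ℚ)) with hl
    have hl_apply : ∀ i, l i = (z i : ℚ) := fun i => by simp [hl]
    have hl_supp : l ∈ Finsupp.supported ℚ ℚ B := by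
      rw [Finsupp.mem_supported]
      intro i hi
      by_contra hiB
      have : z i = 0 := hsupp i (by simpa using hiB)
      apply (Finsupp.mem_support_iff.mp hi)
      rw [hl_apply, this, Int.cast_zero]
    have hcomb : Finsupp.linearCombination ℚ v l = 0 := by
      rw [Finsupp.linearCombination_apply, Finsupp.sum_fintype _ _ (fun i => by simp)]
      simp only [hl_apply, hv]
      rw [← hπz, castQL_eq_sum_single, map_sum]
      refine Finset.sum_congr rfl fun i _ => ?_
      rw [map_smul]
    have hl0 : l = 0 := (linearIndepOn_iff.mp hliB) l hl_supp hcomb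
    funext i
    have := congrArg (fun f : ι →₀ ℚ => f i) hl0
    simp only [hl_apply, Finsupp.coe_zero, Pi.zero_apply, Int.cast_eq_zero] at this
    exact this
  · -- (ii) `|B| + rang N ≥ |ι|`
    have hrange : span ℚ (Set.range v) = ⊤ := by
      have h1 : span ℚ (Set.range e) = ⊤ := by
        have hfe : (⇑(Pi.basisFun ℚ ι) : ι → ι → ℚ) = e := by
          funext i; rw [he, Pi.basisFun_apply]
        rw [← hfe]; exact (Pi.basisFun ℚ ι).span_eq
      rw [show Set.range v = π '' Set.range e by rw [hv, ← Set.range_comp]; rfl, ← Submodule.map_span, h1,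
        Submodule.map_top, hπ, Submodule.range_mkQ]
    have hspanB' : span ℚ (v '' B) = ⊤ := by
      apply le_antisymm le_top
      rw [← hrange]
      refine span_le.mpr ?_
      rw [Set.image_univ] at hspanB
      exact hspanB
    have hQ : Module.finrank ℚ ((ι → ℚ) ⧸ NQ) + Module.finrank ℚ NQ = Fintype.card ι := by
      rw [Submodule.finrank_quotient_add_finrank, Module.finrank_fintype_fun_eq_card]
    have hB : Module.finrank ℚ ((ι → ℚ) ⧸ NQ) ≤ B.toFinset.card := by
      rw [← finrank_top ℚ ((ι → ℚ) ⧸ NQ), ← hspanB']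
      calc Module.finrank ℚ ↥(span ℚ (v '' B)) ≤ (v '' B).toFinset.card := finrank_span_le_card _
        _ ≤ B.toFinset.card := by
            rw [Set.toFinset_image]
            exact Finset.card_image_le
    have hN : Module.finrank ℚ NQ = Module.finrank ℤ N := finrank_span_castQL N
    omega
  · -- (iii) `|B ∩ P| + rang(N ∩ ℤ^P) ≥ |P|`
    set UP : Submodule ℚ (ι → ℚ) := span ℚ (e '' (↑P : Set ι)) with hUP
    -- `dim U_P = |P|`
    have hUPdim : Module.finrank ℚ UP = P.card := by
      have hli : LinearIndependent ℚ (fun i : (↑P : Set ι) => e i) := by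
        have := (Pi.basisFun ℚ ι).linearIndependent
        have h2 : (fun i : (↑P : Set ι) => e i) = (Pi.basisFun ℚ ι) ∘ (Subtype.val : (↑P : Set ι) → ι) := by
          funext i; simp [he, Pi.basisFun_apply]
        rw [h2]
        exact this.comp _ Subtype.val_injective
      have hUPeq : UP = span ℚ (Set.range fun i : (↑P : Set ι) => e i) := by
        rw [hUP, Set.image_eq_range]
      rw [hUPeq, finrank_span_eq_card hli]
      simp
    -- `dim (U_P.map π) + dim (U_P ∩ N_ℚ) = |P|`
    haveI : FiniteDimensional ℚ UP := inferInstance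
    have hmap := finrank_map_add_finrank_inf_ker_field UP π
    rw [hπ, Submodule.ker_mkQ] at hmap
    -- `U_P.map π ≤ span (v '' ba)`, so its dimension is `≤ |ba| ≤ |B ∩ P|`
    have hle1 : Module.finrank ℚ ↥(UP.map NQ.mkQ) ≤ (B.toFinset.filter (· ∈ P)).card := by
      have hsub : UP.map NQ.mkQ ≤ span ℚ (v '' ba) := by
        rw [hUP, Submodule.map_span]
        refine span_le.mpr ?_
        have : NQ.mkQ '' (e '' (↑P : Set ι)) = v '' (↑P : Set ι) := by
          rw [Set.image_image]
        rw [this]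
        exact hspan_a
      calc Module.finrank ℚ ↥(UP.map NQ.mkQ) ≤ Module.finrank ℚ ↥(span ℚ (v '' ba)) := Submodule.finrank_mono hsub
        _ ≤ (v '' ba).toFinset.card := finrank_span_le_card _
        _ ≤ ba.toFinset.card := by rw [Set.toFinset_image]; exact Finset.card_image_le
        _ ≤ (B.toFinset.filter (· ∈ P)).card := by
            apply Finset.card_le_card
            intro i hi
            rw [Set.mem_toFinset] at hi
            rw [Finset.mem_filter, Set.mem_toFinset]
            exact ⟨hbaB hi, hba_sub hi⟩
    -- `dim (U_P ∩ N_ℚ) ≤ rang (N ∩ ℤ^P)`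
    have hle2 : Module.finrank ℚ ↥(UP ⊓ NQ) ≤ Module.finrank ℤ ↥(N ⊓ suppZ (↑P : Set ι)) := by
      rw [← finrank_span_castQL (N ⊓ suppZ (↑P : Set ι))]
      apply Submodule.finrank_mono
      intro x hx
      obtain ⟨hxU, hxN⟩ := Submodule.mem_inf.mp hx
      -- `x` is supported in `P`
      have hxsupp : ∀ i, i ∉ (↑P : Set ι) → x i = 0 := by
        -- `U_P` is spanned by vectors supported in `P`
        have hle : UP ≤ suppQ (↑P : Set ι) := by
          rw [hUP]
          refine span_le.mpr ?_
          rintro _ ⟨i, hi, rfl⟩ j hj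
          have hij : j ≠ i := fun h => hj (h ▸ hi)
          simp [he, Pi.single_eq_of_ne hij]
        exact hle hxU
      obtain ⟨k, hk, n, hn, hkx⟩ := (mem_span_castQL_iff N x).mp hxN
      have hnP : n ∈ suppZ (↑P : Set ι) := by
        intro i hi
        have h := congrFun hkx i
        simp only [Pi.smul_apply, smul_eq_mul, castQL_apply] at h
        rw [hxsupp i hi, mul_zero] at h
        exact_mod_cast h.symm
      exact (mem_span_castQL_iff (N ⊓ suppZ (↑P : Set ι)) x).mpr ⟨k, hk, n, Submodule.mem_inf.mpr ⟨hn, hnP⟩, hkx⟩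
    omega

end RoyWaldschmidt1997

end Literature.NumberTheory.Transcendental
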